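import Literature.NumberTheory.CubicFields.PureCubicLatticeHNF
import HarnessLib

/-!
# The three-column Hermite normal form, II: uniqueness and canonical lattice codes

Topic `NumberTheory/CubicFields`; theorem-only sequel of `PureCubicLatticeHNF.lean`.

* `eq_of_isHNF_of_rowSpan_eq` — **uniqueness of the Hermite normal form**: two HNF triples with
  the same row span coincide (Cohen GTM 138 Thm. 2.4.3);
* `tgcd_pos`, `tgcd_dvd`, `rowsOf_codeOf`, `scale_rowsOf_codeOf` — the normalisation `codeOf D s`
  divides denominator and entries by their total gcd; `canon_codeOf` — and its output is a
  canonical code when `s` is in HNF; `canon_latOfGens` — so is `latOfGens D gens` for a full-rank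
  list; `mem_rowSpan_scale_iff` — the span of `g · t` is `g ·` the span of `t`;
* `rowsOf_eq_of`, `isHNF_rowsOf_of_canon`, `eq_of_canon` — canonical codes with the same
  denominator and the same row span are equal; `scaleRow_mem_rowSpan` — the span of an echelon
  triple contains `(r₁₁ r₂₂ r₃₃) · ℤ³`.

## References

* H. Cohen, *A Course in Computational Algebraic Number Theory*, GTM 138, Springer 1993, §2.4.2
  (Thm. 2.4.3), §4.7.1. [Cohen1993]
-/

namespace Literature.NumberTheory.CubicFields

namespace PureCubicCodes

/-! ### Uniqueness of the Hermite normal form -/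

/-- **Uniqueness of the Hermite normal form** (three columns, full rank): HNF triples with equal
row spans are equal. [cite: Cohen1993, §2.4.2 (Thm. 2.4.3, uniqueness)] -/
theorem eq_of_isHNF_of_rowSpan_eq {s s' : Rows} (hs : IsHNF s) (hs' : IsHNF s')
    (h : rowSpan s = rowSpan s') : s = s' := by
  obtain ⟨⟨a21, a31, a32⟩, a11, a22, a33, a12, a12', a13, a13', a23, a23'⟩ := hs
  obtain ⟨⟨b21, b31, b32⟩, b11, b22, b33, b12, b12', b13, b13', b23, b23'⟩ := hs'
  have m1 := mem_rowSpan_self s'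
  have m2 := mem_rowSpan_self s
  rw [← h] at m1
  rw [h] at m2
  obtain ⟨u₁, v₁, w₁, e₁⟩ := mem_rowSpan_iff.1 m1.1
  obtain ⟨u₂, v₂, w₂, e₂⟩ := mem_rowSpan_iff.1 m1.2.1
  obtain ⟨u₃, v₃, w₃, e₃⟩ := mem_rowSpan_iff.1 m1.2.2
  obtain ⟨u₄, v₄, w₄, e₄⟩ := mem_rowSpan_iff.1 m2.1
  obtain ⟨u₅, v₅, w₅, e₅⟩ := mem_rowSpan_iff.1 m2.2.1
  obtain ⟨u₆, v₆, w₆, e₆⟩ := mem_rowSpan_iff.1 m2.2.2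
  simp only [Prod.ext_iff, a21, a31, a32, b21, b31, b32, mul_zero, add_zero] at e₁ e₂ e₃ e₄ e₅ e₆
  obtain ⟨e11, e12, e13⟩ := e₁
  obtain ⟨e21, e22, e23⟩ := e₂
  obtain ⟨e31, e32, e33⟩ := e₃
  obtain ⟨f11, -, -⟩ := e₄
  obtain ⟨f21, f22, -⟩ := e₅
  obtain ⟨f31, f32, f33⟩ := e₆
  -- third row
  have hu₃ : u₃ = 0 := (mul_eq_zero.1 e31.symm).resolve_right a11.ne'
  rw [hu₃, zero_mul, zero_add] at e32 e33
  have hv₃ : v₃ = 0 := (mul_eq_zero.1 e32.symm).resolve_right a22.ne'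
  rw [hv₃, zero_mul, zero_add] at e33
  have hu₆ : u₆ = 0 := (mul_eq_zero.1 f31.symm).resolve_right b11.ne'
  rw [hu₆, zero_mul, zero_add] at f32 f33
  have hv₆ : v₆ = 0 := (mul_eq_zero.1 f32.symm).resolve_right b22.ne'
  rw [hv₆, zero_mul, zero_add] at f33
  have d33 : s.2.2.2.2 = s'.2.2.2.2 :=
    Int.dvd_antisymm a33.le b33.le ⟨w₃, by rw [e33]; ring⟩ ⟨w₆, by rw [f33]; ring⟩
  -- second row
  have hu₂ : u₂ = 0 := (mul_eq_zero.1 e21.symm).resolve_right a11.ne'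
  rw [hu₂, zero_mul, zero_add] at e22 e23
  have hu₅ : u₅ = 0 := (mul_eq_zero.1 f21.symm).resolve_right b11.ne'
  rw [hu₅, zero_mul, zero_add] at f22
  have d22 : s.2.1.2.1 = s'.2.1.2.1 :=
    Int.dvd_antisymm a22.le b22.le ⟨v₂, by rw [e22]; ring⟩ ⟨v₅, by rw [f22]; ring⟩
  have hv₂ : v₂ = 1 := by
    refine mul_right_cancel₀ a22.ne' ?_
    rw [one_mul, ← e22, d22]
  rw [hv₂, one_mul] at e23
  have d23 : s.2.1.2.2 = s'.2.1.2.2 := by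
    symm
    calc s'.2.1.2.2 = s'.2.1.2.2 % s'.2.2.2.2 := (Int.emod_eq_of_lt b23 b23').symm
      _ = (s.2.1.2.2 + w₂ * s.2.2.2.2) % s.2.2.2.2 := by rw [e23, d33]
      _ = s.2.1.2.2 := by rw [Int.add_mul_emod_self_right, Int.emod_eq_of_lt a23 a23']
  -- first row
  have d11 : s.1.1 = s'.1.1 :=
    Int.dvd_antisymm a11.le b11.le ⟨u₁, by rw [e11]; ring⟩ ⟨u₄, by rw [f11]; ring⟩
  have hu₁ : u₁ = 1 := by
    refine mul_right_cancel₀ a11.ne' ?_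
    rw [one_mul, ← e11, d11]
  rw [hu₁, one_mul] at e12 e13
  have d12 : s.1.2.1 = s'.1.2.1 := by
    symm
    calc s'.1.2.1 = s'.1.2.1 % s'.2.1.2.1 := (Int.emod_eq_of_lt b12 b12').symm
      _ = (s.1.2.1 + v₁ * s.2.1.2.1) % s.2.1.2.1 := by rw [e12, d22]
      _ = s.1.2.1 := by rw [Int.add_mul_emod_self_right, Int.emod_eq_of_lt a12 a12']
  have hv₁ : v₁ = 0 := by
    have h0 : v₁ * s.2.1.2.1 = 0 := by linarith
    exact (mul_eq_zero.1 h0).resolve_right a22.ne'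
  rw [hv₁, zero_mul, add_zero] at e13
  have d13 : s.1.2.2 = s'.1.2.2 := by
    symm
    calc s'.1.2.2 = s'.1.2.2 % s'.2.2.2.2 := (Int.emod_eq_of_lt b13 b13').symm
      _ = (s.1.2.2 + w₁ * s.2.2.2.2) % s.2.2.2.2 := by rw [e13, d33]
      _ = s.1.2.2 := by rw [Int.add_mul_emod_self_right, Int.emod_eq_of_lt a13 a13']
  exact Prod.ext (Prod.ext d11 (Prod.ext d12 d13))
    (Prod.ext (Prod.ext (by rw [a21, b21]) (Prod.ext d22 d23))
      (Prod.ext (by rw [a31, b31]) (Prod.ext (by rw [a32, b32]) d33)))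

/-! ### The normalisation `codeOf` -/

/-- The total gcd of a positive denominator is positive. [folklore] -/
theorem tgcd_pos {D : ℕ} (hD : 1 ≤ D) (s : Rows) : 0 < tgcd D s := by
  unfold tgcd
  exact Int.gcd_pos_of_ne_zero_left _ (by exact_mod_cast (show D ≠ 0 by omega))

/-- The total gcd divides the denominator and the six upper entries. [folklore] -/
theorem tgcd_dvd (D : ℕ) (s : Rows) :
    ((tgcd D s : ℕ) : ℤ) ∣ (D : ℤ) ∧ ((tgcd D s : ℕ) : ℤ) ∣ s.1.1 ∧ ((tgcd D s : ℕ) : ℤ) ∣ s.1.2.1 ∧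
      ((tgcd D s : ℕ) : ℤ) ∣ s.1.2.2 ∧ ((tgcd D s : ℕ) : ℤ) ∣ s.2.1.2.1 ∧ ((tgcd D s : ℕ) : ℤ) ∣ s.2.1.2.2 ∧
      ((tgcd D s : ℕ) : ℤ) ∣ s.2.2.2.2 := by
  unfold tgcd
  set G₅ := Int.gcd s.2.1.2.2 s.2.2.2.2 with hG₅
  set G₄ := Int.gcd s.2.1.2.1 G₅ with hG₄
  set G₃ := Int.gcd s.1.2.2 G₄ with hG₃
  set G₂ := Int.gcd s.1.2.1 G₃ with hG₂
  set G₁ := Int.gcd s.1.1 G₂ with hG₁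
  set g := Int.gcd (D : ℤ) G₁ with hg
  have d1 : (g : ℤ) ∣ (G₁ : ℤ) := Int.gcd_dvd_right _ _
  have d2 : (g : ℤ) ∣ (G₂ : ℤ) := d1.trans (Int.gcd_dvd_right _ _)
  have d3 : (g : ℤ) ∣ (G₃ : ℤ) := d2.trans (Int.gcd_dvd_right _ _)
  have d4 : (g : ℤ) ∣ (G₄ : ℤ) := d3.trans (Int.gcd_dvd_right _ _)
  have d5 : (g : ℤ) ∣ (G₅ : ℤ) := d4.trans (Int.gcd_dvd_right _ _)
  exact ⟨Int.gcd_dvd_left _ _, d1.trans (Int.gcd_dvd_left _ _), d2.trans (Int.gcd_dvd_left _ _),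
    d3.trans (Int.gcd_dvd_left _ _), d4.trans (Int.gcd_dvd_left _ _), d5.trans (Int.gcd_dvd_left _ _),
    d5.trans (Int.gcd_dvd_right _ _)⟩

/-- The rows of the normalised code are the rows of `s` divided by the total gcd (for echelon `s`).
[folklore] -/
theorem rowsOf_codeOf (D : ℕ) (s : Rows) : rowsOf (codeOf D s) =
    ((s.1.1 / tgcd D s, s.1.2.1 / tgcd D s, s.1.2.2 / tgcd D s),
      (0, s.2.1.2.1 / tgcd D s, s.2.1.2.2 / tgcd D s), (0, 0, s.2.2.2.2 / tgcd D s)) := by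
  simp [rowsOf, codeOf]

/-- An echelon triple is the total gcd times the rows of its normalised code. [folklore] -/
theorem scale_rowsOf_codeOf {D : ℕ} {s : Rows} (hs : IsEch s) :
    s = (scaleRow (tgcd D s) (rowsOf (codeOf D s)).1, scaleRow (tgcd D s) (rowsOf (codeOf D s)).2.1,
      scaleRow (tgcd D s) (rowsOf (codeOf D s)).2.2) := by
  obtain ⟨h21, h31, h32⟩ := hs
  obtain ⟨-, d11, d12, d13, d22, d23, d33⟩ := tgcd_dvd D s
  rw [rowsOf_codeOf]
  simp only [scaleRow, mul_zero]
  refine Prod.ext (Prod.ext ?_ (Prod.ext ?_ ?_)) (Prod.ext (Prod.ext h21 (Prod.ext ?_ ?_))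
    (Prod.ext h31 (Prod.ext h32 ?_))) <;> dsimp only <;> rw [Int.mul_ediv_cancel']
  exacts [d11, d12, d13, d22, d23, d33]

/-- **The span of a scaled triple**: `r ∈ rowSpan (g · t) ↔ r = g · r'` with `r' ∈ rowSpan t`. [folklore] -/
theorem mem_rowSpan_scale_iff (g : ℤ) (t : Rows) (r : Row) :
    r ∈ rowSpan (scaleRow g t.1, scaleRow g t.2.1, scaleRow g t.2.2) ↔
      ∃ r' ∈ rowSpan t, r = scaleRow g r' := by
  constructor
  · intro hr
    obtain ⟨u, v, w, rfl⟩ := mem_rowSpan_iff.1 hr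
    refine ⟨_, mem_rowSpan_iff.2 ⟨u, v, w, rfl⟩, ?_⟩
    refine Prod.ext ?_ (Prod.ext ?_ ?_) <;> simp only [scaleRow] <;> ring
  · rintro ⟨r', hr', rfl⟩
    obtain ⟨u, v, w, rfl⟩ := mem_rowSpan_iff.1 hr'
    refine mem_rowSpan_iff.2 ⟨u, v, w, ?_⟩
    refine Prod.ext ?_ (Prod.ext ?_ ?_) <;> simp only [scaleRow] <;> ring

/-- **The normalised code of an HNF triple with positive denominator is canonical.** [cite: Cohen1993, §4.7.1] -/
theorem canon_codeOf {D : ℕ} (hD : 1 ≤ D) {s : Rows} (hs : IsHNF s) : Canon (codeOf D s) := by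
  obtain ⟨-, a11, a22, a33, a12, a12', a13, a13', a23, a23'⟩ := hs
  obtain ⟨d0, d11, d12, d13, d22, d23, d33⟩ := tgcd_dvd D s
  have hg := tgcd_pos hD s
  have hgz : (0 : ℤ) < tgcd D s := by exact_mod_cast hg
  set g := tgcd D s with hgdef
  refine ⟨s.1.1 / g, s.1.2.1 / g, s.1.2.2 / g, s.2.1.2.1 / g, s.2.1.2.2 / g, s.2.2.2.2 / g, rfl, ?_, ?_, ?_, ?_, ?_,
    ?_, ?_, ?_, ?_, ?_, ?_⟩
  · exact Int.ediv_pos_of_pos_of_dvd a11 hgz.le d11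
  · exact Int.ediv_pos_of_pos_of_dvd a22 hgz.le d22
  · exact Int.ediv_pos_of_pos_of_dvd a33 hgz.le d33
  · exact Int.ediv_nonneg a12 hgz.le
  · exact Int.ediv_lt_ediv_of_lt a12' d22 hgz
  · exact Int.ediv_nonneg a13 hgz.le
  · exact Int.ediv_lt_ediv_of_lt a13' d33 hgz
  · exact Int.ediv_nonneg a23 hgz.le
  · exact Int.ediv_lt_ediv_of_lt a23' d33 hgz
  · change 1 ≤ D / g
    exact (Nat.le_div_iff_mul_le hg).2 (by simpa using Nat.le_of_dvd (by omega) (by exact_mod_cast d0))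
  · change Int.gcd ((D / g : ℕ) : ℤ) _ = 1
    have hDg : ((D / g : ℕ) : ℤ) = (D : ℤ) / (g : ℤ) := Int.natCast_ediv D g
    have e5 : ((Int.gcd (s.2.1.2.2 / g) (s.2.2.2.2 / g) : ℕ) : ℤ) = (Int.gcd s.2.1.2.2 s.2.2.2.2 : ℤ) / g := by
      rw [Int.gcd_ediv d23 d33, Int.natAbs_natCast, Int.natCast_ediv]
    have dd5 : (g : ℤ) ∣ (Int.gcd s.2.1.2.2 s.2.2.2.2 : ℤ) := Int.dvd_coe_gcd d23 d33
    have e4 : ((Int.gcd (s.2.1.2.1 / g) ((Int.gcd s.2.1.2.2 s.2.2.2.2 : ℤ) / g) : ℕ) : ℤ) =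
        (Int.gcd s.2.1.2.1 (Int.gcd s.2.1.2.2 s.2.2.2.2) : ℤ) / g := by
      rw [Int.gcd_ediv d22 dd5, Int.natAbs_natCast, Int.natCast_ediv]
    have dd4 : (g : ℤ) ∣ (Int.gcd s.2.1.2.1 (Int.gcd s.2.1.2.2 s.2.2.2.2) : ℤ) := Int.dvd_coe_gcd d22 dd5
    have e3 : ((Int.gcd (s.1.2.2 / g) ((Int.gcd s.2.1.2.1 (Int.gcd s.2.1.2.2 s.2.2.2.2) : ℤ) / g) : ℕ) : ℤ) =
        (Int.gcd s.1.2.2 (Int.gcd s.2.1.2.1 (Int.gcd s.2.1.2.2 s.2.2.2.2)) : ℤ) / g := by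
      rw [Int.gcd_ediv d13 dd4, Int.natAbs_natCast, Int.natCast_ediv]
    have dd3 : (g : ℤ) ∣ (Int.gcd s.1.2.2 (Int.gcd s.2.1.2.1 (Int.gcd s.2.1.2.2 s.2.2.2.2)) : ℤ) :=
      Int.dvd_coe_gcd d13 dd4
    have e2 : ((Int.gcd (s.1.2.1 / g) ((Int.gcd s.1.2.2 (Int.gcd s.2.1.2.1 (Int.gcd s.2.1.2.2 s.2.2.2.2)) : ℤ) / g)
        : ℕ) : ℤ) = (Int.gcd s.1.2.1 (Int.gcd s.1.2.2 (Int.gcd s.2.1.2.1 (Int.gcd s.2.1.2.2 s.2.2.2.2))) : ℤ) / g := by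
      rw [Int.gcd_ediv d12 dd3, Int.natAbs_natCast, Int.natCast_ediv]
    have dd2 : (g : ℤ) ∣ (Int.gcd s.1.2.1 (Int.gcd s.1.2.2 (Int.gcd s.2.1.2.1 (Int.gcd s.2.1.2.2 s.2.2.2.2))) : ℤ) :=
      Int.dvd_coe_gcd d12 dd3
    have e1 : ((Int.gcd (s.1.1 / g)
        ((Int.gcd s.1.2.1 (Int.gcd s.1.2.2 (Int.gcd s.2.1.2.1 (Int.gcd s.2.1.2.2 s.2.2.2.2))) : ℤ) / g) : ℕ) : ℤ) =
        (Int.gcd s.1.1 (Int.gcd s.1.2.1 (Int.gcd s.1.2.2 (Int.gcd s.2.1.2.1 (Int.gcd s.2.1.2.2 s.2.2.2.2)))) : ℤ) / g := by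
      rw [Int.gcd_ediv d11 dd2, Int.natAbs_natCast, Int.natCast_ediv]
    have dd1 : (g : ℤ) ∣
        (Int.gcd s.1.1 (Int.gcd s.1.2.1 (Int.gcd s.1.2.2 (Int.gcd s.2.1.2.1 (Int.gcd s.2.1.2.2 s.2.2.2.2)))) : ℤ) :=
      Int.dvd_coe_gcd d11 dd2
    rw [e5, e4, e3, e2, e1, hDg, Int.gcd_ediv d0 dd1, Int.natAbs_natCast]
    exact Nat.div_self hg

/-- **The code of a full-rank list of generators is canonical.** [cite: Cohen1993, §2.4.2, §4.7.1] -/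
theorem canon_latOfGens {D : ℕ} (hD : 1 ≤ D) (gens : List Row) {N : ℤ} (hN : N ≠ 0)
    (h1 : ((N, 0, 0) : Row) ∈ AddSubgroup.closure {x | x ∈ gens})
    (h2 : ((0, N, 0) : Row) ∈ AddSubgroup.closure {x | x ∈ gens})
    (h3 : ((0, 0, N) : Row) ∈ AddSubgroup.closure {x | x ∈ gens}) : Canon (latOfGens D gens) :=
  canon_codeOf hD (isHNF_hnf gens hN h1 h2 h3)

/-! ### Canonical codes and their rows -/

/-- The rows of a code with six entries. [folklore] -/
theorem rowsOf_eq_of {c : ℕ × List ℤ} {h11 h12 h13 h22 h23 h33 : ℤ} (h : c.2 = [h11, h12, h13, h22, h23, h33]) :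
    rowsOf c = ((h11, h12, h13), (0, h22, h23), (0, 0, h33)) := by
  simp [rowsOf, h]

/-- The rows of any code form an echelon triple. [folklore] -/
theorem isEch_rowsOf (c : ℕ × List ℤ) : IsEch (rowsOf c) := ⟨rfl, rfl, rfl⟩

/-- The rows of a canonical code are in Hermite normal form, and its denominator is positive. [cite: Cohen1993, §4.7.1] -/
theorem isHNF_rowsOf_of_canon {c : ℕ × List ℤ} (hc : Canon c) : IsHNF (rowsOf c) ∧ 1 ≤ c.1 := by
  obtain ⟨h11, h12, h13, h22, h23, h33, hc2, a11, a22, a33, a12, a12', a13, a13', a23, a23', hD, -⟩ := hc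
  rw [rowsOf_eq_of hc2]
  exact ⟨⟨⟨rfl, rfl, rfl⟩, a11, a22, a33, a12, a12', a13, a13', a23, a23'⟩, hD⟩

/-- **Canonical codes with the same denominator and the same row span are equal.** [cite: Cohen1993, §2.4.2 (Thm. 2.4.3)] -/
theorem eq_of_canon {c c' : ℕ × List ℤ} (hc : Canon c) (hc' : Canon c') (h1 : c.1 = c'.1)
    (h : rowSpan (rowsOf c) = rowSpan (rowsOf c')) : c = c' := by
  have E := eq_of_isHNF_of_rowSpan_eq (isHNF_rowsOf_of_canon hc).1 (isHNF_rowsOf_of_canon hc').1 h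
  obtain ⟨h11, h12, h13, h22, h23, h33, hc2, -⟩ := hc
  obtain ⟨g11, g12, g13, g22, g23, g33, hc2', -⟩ := hc'
  rw [rowsOf_eq_of hc2, rowsOf_eq_of hc2'] at E
  simp only [Prod.mk.injEq] at E
  obtain ⟨⟨rfl, rfl, rfl⟩, ⟨-, rfl, rfl⟩, -, -, rfl⟩ := E
  exact Prod.ext h1 (hc2.trans hc2'.symm)

/-- **The span of an echelon triple contains `(r₁₁ r₂₂ r₃₃) · ℤ³`.** [folklore] -/
theorem scaleRow_mem_rowSpan {s : Rows} (hs : IsEch s) (r : Row) :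
    scaleRow (s.1.1 * s.2.1.2.1 * s.2.2.2.2) r ∈ rowSpan s := by
  obtain ⟨h21, h31, h32⟩ := hs
  refine mem_rowSpan_iff.2 ⟨r.1 * s.2.1.2.1 * s.2.2.2.2,
    r.2.1 * s.1.1 * s.2.2.2.2 - r.1 * s.1.2.1 * s.2.2.2.2,
    r.2.2 * s.1.1 * s.2.1.2.1 - r.2.1 * s.1.1 * s.2.1.2.2 - r.1 * (s.1.2.2 * s.2.1.2.1 - s.1.2.1 * s.2.1.2.2), ?_⟩
  rw [h21, h31, h32]
  refine Prod.ext ?_ (Prod.ext ?_ ?_) <;> simp only [scaleRow] <;> ring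

/-- Multiplicativity of the total gcd under a common natural factor. [folklore] -/
theorem tgcd_mul (m D : ℕ) (s : Rows) :
    tgcd (m * D) (scaleRow m s.1, scaleRow m s.2.1, scaleRow m s.2.2) = m * tgcd D s := by
  simp only [tgcd, scaleRow, Nat.cast_mul]
  rw [Int.gcd_mul_left, Int.natAbs_natCast, Nat.cast_mul, Int.gcd_mul_left, Int.natAbs_natCast, Nat.cast_mul,
    Int.gcd_mul_left, Int.natAbs_natCast, Nat.cast_mul, Int.gcd_mul_left, Int.natAbs_natCast, Nat.cast_mul,
    Int.gcd_mul_left, Int.natAbs_natCast, Nat.cast_mul, Int.gcd_mul_left, Int.natAbs_natCast]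

/-- A common divisor of the denominator and the six upper entries divides the total gcd. [folklore] -/
theorem dvd_tgcd {k : ℤ} {D : ℕ} {s : Rows} (h0 : k ∣ (D : ℤ)) (h11 : k ∣ s.1.1) (h12 : k ∣ s.1.2.1)
    (h13 : k ∣ s.1.2.2) (h22 : k ∣ s.2.1.2.1) (h23 : k ∣ s.2.1.2.2) (h33 : k ∣ s.2.2.2.2) :
    k ∣ (tgcd D s : ℤ) :=
  Int.dvd_coe_gcd h0 (Int.dvd_coe_gcd h11 (Int.dvd_coe_gcd h12 (Int.dvd_coe_gcd h13
    (Int.dvd_coe_gcd h22 (Int.dvd_coe_gcd h23 h33)))))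

/-- The last clause of `Canon` is `tgcd den (rows) = 1`. [folklore] -/
theorem tgcd_eq_one_of_canon {c : ℕ × List ℤ} (hc : Canon c) : tgcd c.1 (rowsOf c) = 1 := by
  obtain ⟨h11, h12, h13, h22, h23, h33, hc2, -, -, -, -, -, -, -, -, -, -, hg⟩ := hc
  rw [rowsOf_eq_of hc2]
  exact hg

/-! ### Integer combinations in subgroups; products of rows -/

/-- A three-term integer combination of members of a subgroup is a member. [folklore] -/
theorem combo3_mem {S : AddSubgroup Row} {g₁ g₂ g₃ : Row} (h₁ : g₁ ∈ S) (h₂ : g₂ ∈ S) (h₃ : g₃ ∈ S)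
    (u v w : ℤ) :
    ((u * g₁.1 + v * g₂.1 + w * g₃.1, u * g₁.2.1 + v * g₂.2.1 + w * g₃.2.1,
      u * g₁.2.2 + v * g₂.2.2 + w * g₃.2.2) : Row) ∈ S := by
  have e : ((u * g₁.1 + v * g₂.1 + w * g₃.1, u * g₁.2.1 + v * g₂.2.1 + w * g₃.2.1,
      u * g₁.2.2 + v * g₂.2.2 + w * g₃.2.2) : Row) = u • g₁ + v • g₂ + w • g₃ := by
    rw [zsmul_row, zsmul_row, zsmul_row]; rfl
  rw [e]
  exact S.add_mem (S.add_mem (S.zsmul_mem h₁ u) (S.zsmul_mem h₂ v)) (S.zsmul_mem h₃ w)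

/-- The subgroup generated by a three-item list is the row span of the triple. [folklore] -/
theorem closure_list3 (g₁ g₂ g₃ : Row) :
    AddSubgroup.closure {x | x ∈ [g₁, g₂, g₃]} = rowSpan (g₁, g₂, g₃) := by
  rw [rowSpan]
  congr 1
  ext x
  simp

/-- The subgroup generated by a four-item list. [folklore] -/
theorem closure_list4 (g₁ g₂ g₃ g₄ : Row) :
    AddSubgroup.closure {x | x ∈ [g₁, g₂, g₃, g₄]} = rowSpan (g₁, g₂, g₃) ⊔ AddSubgroup.closure {g₄} := by
  rw [rowSpan, ← AddSubgroup.closure_union]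
  congr 1
  ext x
  simp only [List.mem_cons, List.not_mem_nil, or_false, Set.mem_setOf_eq, Set.mem_union, Set.mem_insert_iff,
    Set.mem_singleton_iff]
  tauto

/-- Membership in `rowSpan t + ℤ g`: four-term combinations. [folklore] -/
theorem mem_rowSpan_sup_iff {t : Rows} {g r : Row} :
    r ∈ rowSpan t ⊔ AddSubgroup.closure {g} ↔ ∃ u v w k : ℤ,
      r = (u * t.1.1 + v * t.2.1.1 + w * t.2.2.1 + k * g.1, u * t.1.2.1 + v * t.2.1.2.1 + w * t.2.2.2.1 + k * g.2.1,
        u * t.1.2.2 + v * t.2.1.2.2 + w * t.2.2.2.2 + k * g.2.2) := by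
  rw [AddSubgroup.mem_sup]
  constructor
  · rintro ⟨y, hy, z, hz, rfl⟩
    obtain ⟨u, v, w, rfl⟩ := mem_rowSpan_iff.1 hy
    obtain ⟨k, rfl⟩ := AddSubgroup.mem_closure_singleton.1 hz
    refine ⟨u, v, w, k, ?_⟩
    rw [zsmul_row]
    rfl
  · rintro ⟨u, v, w, k, rfl⟩
    refine ⟨_, mem_rowSpan_iff.2 ⟨u, v, w, rfl⟩, k • g, AddSubgroup.mem_closure_singleton.2 ⟨k, rfl⟩, ?_⟩
    rw [zsmul_row]
    rfl

/-- `mulRow` is additive in the first factor (three-term combinations). [folklore] -/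
theorem mulRow_combo_left (a b u v w : ℤ) (p q r t : Row) :
    mulRow a b (u * p.1 + v * q.1 + w * r.1, u * p.2.1 + v * q.2.1 + w * r.2.1, u * p.2.2 + v * q.2.2 + w * r.2.2) t =
      (u * (mulRow a b p t).1 + v * (mulRow a b q t).1 + w * (mulRow a b r t).1,
        u * (mulRow a b p t).2.1 + v * (mulRow a b q t).2.1 + w * (mulRow a b r t).2.1,
        u * (mulRow a b p t).2.2 + v * (mulRow a b q t).2.2 + w * (mulRow a b r t).2.2) := by
  refine Prod.ext ?_ (Prod.ext ?_ ?_) <;> simp only [mulRow] <;> ring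

/-- `mulRow` is additive in the second factor (three-term combinations). [folklore] -/
theorem mulRow_combo_right (a b u v w : ℤ) (t p q r : Row) :
    mulRow a b t (u * p.1 + v * q.1 + w * r.1, u * p.2.1 + v * q.2.1 + w * r.2.1, u * p.2.2 + v * q.2.2 + w * r.2.2) =
      (u * (mulRow a b t p).1 + v * (mulRow a b t q).1 + w * (mulRow a b t r).1,
        u * (mulRow a b t p).2.1 + v * (mulRow a b t q).2.1 + w * (mulRow a b t r).2.1,
        u * (mulRow a b t p).2.2 + v * (mulRow a b t q).2.2 + w * (mulRow a b t r).2.2) := by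
  refine Prod.ext ?_ (Prod.ext ?_ ?_) <;> simp only [mulRow] <;> ring

/-- Scalars pass through `mulRow`. [folklore] -/
theorem mulRow_scaleRow_left (a b k : ℤ) (p t : Row) : mulRow a b (scaleRow k p) t = scaleRow k (mulRow a b p t) := by
  refine Prod.ext ?_ (Prod.ext ?_ ?_) <;> simp only [mulRow, scaleRow] <;> ring

/-- **The adjugate rows**: three explicit rows whose products with `t` are `N(t) e₁, N(t) e₂, N(t) e₃`
(the cofactors of the multiplication-by-`t` matrix). [cite: Cohen1993, §6.4.5] -/
theorem mulRow_adj (a b : ℤ) (t : Row) :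
    mulRow a b (t.1 ^ 2 - a * b * t.2.1 * t.2.2, a * t.2.2 ^ 2 - t.1 * t.2.1, b * t.2.1 ^ 2 - t.1 * t.2.2) t =
        (normRow a b t, 0, 0) ∧
      mulRow a b (a * b * (b * t.2.1 ^ 2 - t.1 * t.2.2), t.1 ^ 2 - a * b * t.2.1 * t.2.2,
          b * (a * t.2.2 ^ 2 - t.1 * t.2.1)) t = (0, normRow a b t, 0) ∧
      mulRow a b (a * b * (a * t.2.2 ^ 2 - t.1 * t.2.1), a * (b * t.2.1 ^ 2 - t.1 * t.2.2),
          t.1 ^ 2 - a * b * t.2.1 * t.2.2) t = (0, 0, normRow a b t) := by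
  refine ⟨?_, ?_, ?_⟩ <;> refine Prod.ext ?_ (Prod.ext ?_ ?_) <;> simp only [mulRow, normRow] <;> ring

/-- Products of coordinate multiples of `e₁, e₂, e₃` with a multiple of `e₁ = 1`. [folklore] -/
theorem mulRow_axes (a b P Q : ℤ) :
    mulRow a b (P, 0, 0) (Q, 0, 0) = (P * Q, 0, 0) ∧ mulRow a b (0, P, 0) (Q, 0, 0) = (0, P * Q, 0) ∧
      mulRow a b (0, 0, P) (Q, 0, 0) = (0, 0, P * Q) := by
  simp [mulRow]

/-- **Bilinearity**: the product of a member of `rowSpan R` and a member of `rowSpan S` lies in the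
subgroup generated by the nine products of basis rows. [folklore] -/
theorem mulRow_mem_closure9 (a b : ℤ) (R S : Rows) {s₁ s₂ : Row} (h₁ : s₁ ∈ rowSpan R) (h₂ : s₂ ∈ rowSpan S) :
    mulRow a b s₁ s₂ ∈ AddSubgroup.closure {x | x ∈ [mulRow a b R.1 S.1, mulRow a b R.1 S.2.1, mulRow a b R.1 S.2.2,
      mulRow a b R.2.1 S.1, mulRow a b R.2.1 S.2.1, mulRow a b R.2.1 S.2.2,
      mulRow a b R.2.2 S.1, mulRow a b R.2.2 S.2.1, mulRow a b R.2.2 S.2.2]} := by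
  set L := [mulRow a b R.1 S.1, mulRow a b R.1 S.2.1, mulRow a b R.1 S.2.2,
      mulRow a b R.2.1 S.1, mulRow a b R.2.1 S.2.1, mulRow a b R.2.1 S.2.2,
      mulRow a b R.2.2 S.1, mulRow a b R.2.2 S.2.1, mulRow a b R.2.2 S.2.2] with hL
  have m : ∀ y ∈ L, y ∈ AddSubgroup.closure {x | x ∈ L} := fun y hy => AddSubgroup.subset_closure hy
  simp only [hL, List.forall_mem_cons] at m
  obtain ⟨m11, m12, m13, m21, m22, m23, m31, m32, m33, -⟩ := m
  obtain ⟨u, v, w, rfl⟩ := mem_rowSpan_iff.1 h₁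
  obtain ⟨u', v', w', rfl⟩ := mem_rowSpan_iff.1 h₂
  rw [mulRow_combo_left]
  refine combo3_mem ?_ ?_ ?_ u v w <;> rw [mulRow_combo_right]
  · exact combo3_mem m11 m12 m13 u' v' w'
  · exact combo3_mem m21 m22 m23 u' v' w'
  · exact combo3_mem m31 m32 m33 u' v' w'

end PureCubicCodes

end Literature.NumberTheory.CubicFields
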